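import Summits.BirchSwinnertonDyer.Rank1Residual.ManinAdditive.BlindFamilyBSDTwo
import HarnessLib
import HarnessLib.Audit.Tags

/-!
# THEOREM D (an g23 MEMO-an §65.J): on the TAME blind family, odd modular degree ⟹ the `2`-part of BSD — typed rows
# E-an-106♭ / 106♯ / 106 and the kernel-checked assembly (cell `bsd-f2-manin`, T-an-29; typer g13)

SOURCE = HOME/an/Sketch-an-g23.lean 400c28f5dc912b9f «Part D / §OddDegree» (l. 835–916), VERBATIM up to the `@[conjecture]`
tags.  Paper chain (labelled inputs): odd `deg φ₀` ⟹ (§60 THEOREM C, accepted at `N = 4p` in both directions by REF1 §R59/§R68)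
`φ₀(0) = T` ⟹ (es §28.14) `[0]⁺_f ∈ ½ + ℤ` and `L(E′_m,1) ≠ 0`; odd `deg φ₀` ⟹ (ČNS Thm 1.2 at `N = 4p`, tree E-an-72 over the
cite-only fact) `2 ∤ c₀`; then `v₂(L/Ω_E) = −1` = BSD₂ by the sibling file (descent: `#Ш` odd, `Reg = 1`; Tate: `#tors = 2`,
`∏c = 2c₂` odd; `Ш` finite kept as a binder).  ROWS (`@[conjecture]`, nothing asserted): **E-an-106♭ `BlindTameOddDegreeCuspHalf`**
(ℕ-witness ⇒ also asserts `ratPlusSymbol D.f 0 > 0`, REF1 H-1 [Guo 1996]), **E-an-106♯ `BlindTameOddDegreeManinOdd`**,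
**E-an-106 `BlindTameOddDegreeBSDTwo`** (THEOREM D); PROVED: `analyticRank_eq_zero_of_entireLFunction_one_ne_zero'`,
`analyticRank_eq_zero_of_ratPlusSymbol_halfUnit`, **`blindTameOddDegreeBSDTwo_of : 103 → 106♭ → 106♯ → 106`**.
REF1 §R68: 106♭/106♯/106 SURVIVE (conditional theorems), closure standard.  bears_on: stmt-BirchSwinnertonDyer-22967.
PARTITION 0 · beyond-print theorem: no · BSD is not proved by this; Manin's conjecture is not proved by this.
-/

set_option autoImplicit false

noncomputable section

open scoped Classical

namespace Summit.BirchSwinnertonDyer.Rank1Residual.ManinAdditive.BlindFamilyDescent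

open _root_.WeierstrassCurve _root_.WeierstrassCurve.Affine
open Literature.NumberTheory.EllipticCurves Literature.NumberTheory.DiophantineGeometry
open Summit.BirchSwinnertonDyer.Rank1Residual.ManinAdditive.ShimuraLedger (blindCurve sourceCurve)
open Summit.BirchSwinnertonDyer.BirchSwinnertonDyer.Theorems.ManinLocalTwoThree.BlindFamilyDescent

/-! ## Part D — THEOREM D of MEMO-an §65.J: odd modular degree ⟹ the 2-part of BSD (tame blind family)

Paper chain (labelled inputs): odd `deg φ₀` ⟹ (§60 THEOREM C, paper) `φ₀(0) = T` ⟹ (es §28.14,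
elementary: `±c₀·L(f,1) ∈ z(φ₀(0)) + ℤΩ_E`, `Ω_E = |c₀|Ω⁺_f`) `[0]⁺_f ∈ ½ + ℤ` and `L(E′_m,1) ≠ 0`;
odd `deg φ₀` ⟹ (ČNS Thm 1.2 at `N = 4p`, §59 E-an-72/74 kernel edge over the cite-only fact) `2 ∤ c₀`;
then `v₂(L/Ω_E) = v₂([0]⁺_f) − v₂(c₀) = −1` = BSD₂ by Part C (descent: `#Ш` odd, `Reg = 1`; Tate:
`#tors = 2`, `∏c = 2c₂` odd; `Ш` finite from `L ≠ 0` by Kolyvagin — kept as a binder). Below the two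
c-free inputs are Props (E-an-106♭, E-an-106♯) and the assembly is kernel-checked. -/

section OddDegree

open Literature.NumberTheory.EllipticCurves.ModularForms

/-- `L(W,1) ≠ 0` forces analytic rank `0` for a modular `W` (order of vanishing of the entire
continuation; `HasEntireLFunction` from the newform). [cite: BirchSwinnertonDyer1965] -/
theorem analyticRank_eq_zero_of_entireLFunction_one_ne_zero' {W : WeierstrassCurve ℚ} [W.IsElliptic]
    {N : ℕ} [NeZero N] (D : ModularParametrizationData W N) (hL : W.entireLFunction 1 ≠ 0) :
    W.analyticRank = 0 :=
  (W.analyticRank_eq_zero_iff_holds D.isNewformOf.hasEntireLFunction).mpr hL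

/-- A cusp half-unit `2b·[0]⁺_f = a` (`a, b` odd) forces `L(W,1) = [0]⁺_f·Ω⁺_f ≠ 0`, hence analytic
rank `0` — the «hidden content L ≠ 0» of every cusp-bit candidate (R-an-34 (ii)), now a lemma. -/
theorem analyticRank_eq_zero_of_ratPlusSymbol_halfUnit {W : WeierstrassCurve ℚ} [W.IsElliptic]
    {N : ℕ} [NeZero N] (D : ModularParametrizationData W N)
    (hα : ∃ a b : ℕ, ¬ 2 ∣ a ∧ ¬ 2 ∣ b ∧ 2 * (b : ℚ) * ratPlusSymbol D.f 0 = a) :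
    W.analyticRank = 0 := by
  apply analyticRank_eq_zero_of_entireLFunction_one_ne_zero' D
  rw [D.isNewformOf.entireLFunction_one_eq]
  obtain ⟨a, b, ha, hb, h⟩ := hα
  have hr : ratPlusSymbol D.f 0 ≠ 0 := by
    intro h0
    rw [h0, mul_zero] at h
    have ha0 : a = 0 := by exact_mod_cast h.symm
    exact ha (ha0 ▸ dvd_zero 2)
  have hΩ : 0 < plusPeriod D.f :=
    IsNewform0.plusPeriod_pos_holds D.isNewformOf.1 D.isNewformOf.coeffField_eq_bot
  exact_mod_cast mul_ne_zero (Rat.cast_ne_zero.mpr hr : ((ratPlusSymbol D.f 0 : ℚ) : ℝ) ≠ 0) hΩ.ne'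

/-- **E-an-106♭** (c-free input 1 of THEOREM D; §60 THEOREM C + es §28.14): on the TAME blind family
(`m ≡ 1 (mod 4)`, `N = 4(m²+4)`), an `X₀`-optimal parametrisation of ODD modular degree has the cusp
half-unit `[0]⁺_f ∈ ½ + ℤ`. LAW-shaped (paper theorem in the cell, not in Lean).
Cell bsd-f2-manin row E-an-106♭ (THEOREM C chain at 4p + positivity; REF1 §R68: SURVIVES — THEOREM C accepted at N = 4p in both directions (§R59); the ℕ-witness additionally asserts `ratPlusSymbol D.f 0 > 0` = «L(E,1) ≥ 0» [Guo 1996], H-1); theorem target on paper; nothing asserted.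
[conjecture — theorem on paper (cell), NOT yet a tree theorem] -/
@[conjecture]
def BlindTameOddDegreeCuspHalf : Prop :=
  ∀ m : ℤ, Odd m → m % 4 = 1 → 3 ≤ |m| → Nat.Prime (m ^ 2 + 4).natAbs →
    ∀ {N : ℕ} [NeZero N] (D : ModularParametrizationData (blindCurve m) N),
      (∀ z ∈ D.L.lattice, ∃ w ∈ periodLattice D.f, z = D.c * w) → Odd D.deg →
      ∃ a b : ℕ, ¬ 2 ∣ a ∧ ¬ 2 ∣ b ∧ 2 * (b : ℚ) * ratPlusSymbol D.f 0 = a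

/-- **E-an-106♯** (c-free input 2 of THEOREM D; = §59's kernel edge E-an-72/74 over the cite-only ČNS
fact `cesnaviciusNeururerSaha_thm_1_2` at `N = 4p`): odd modular degree ⟹ `2 ∤ c₀` on the tame blind
family.
Cell bsd-f2-manin row E-an-106♯ (= the tree's ČNS-conditional theorem E-an-72 `not_two_dvd_maninConstant_of_cns_of_odd_deg` restricted to N = 4p; REF1 §R68: SURVIVES (conditional theorem)); nothing asserted.
[conjecture — conditional theorem (ČNS Thm 1.2 cite-only), NOT a tree fact] -/
@[conjecture]
def BlindTameOddDegreeManinOdd : Prop :=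
  ∀ m : ℤ, Odd m → m % 4 = 1 → 3 ≤ |m| → Nat.Prime (m ^ 2 + 4).natAbs →
    ∀ {N : ℕ} [NeZero N] (D : ModularParametrizationData (blindCurve m) N),
      (∀ z ∈ D.L.lattice, ∃ w ∈ periodLattice D.f, z = D.c * w) → Odd D.deg → ¬ (2 : ℤ) ∣ D.c

/-- **E-an-106 THEOREM D** (MEMO-an §65.J): on the tame blind family, an `X₀`-optimal member of ODD
modular degree with finite `Ш` satisfies the 2-part of the BSD leading-term formula.
Cell bsd-f2-manin row E-an-106 THEOREM D (REF1 §R68: SURVIVES; assembly `blindTameOddDegreeBSDTwo_of` kernel-checked: 103 ∧ 106♭ ∧ 106♯ ⟹ 106); nothing asserted beyond its inputs.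
[conjecture — conditional theorem, NOT a tree fact] -/
@[conjecture]
def BlindTameOddDegreeBSDTwo : Prop :=
  ∀ m : ℤ, Odd m → m % 4 = 1 → 3 ≤ |m| → Nat.Prime (m ^ 2 + 4).natAbs →
    Finite (blindCurve m).sha →
    ∀ {N : ℕ} [NeZero N] (D : ModularParametrizationData (blindCurve m) N),
      (∀ z ∈ D.L.lattice, ∃ w ∈ periodLattice D.f, z = D.c * w) → Odd D.deg →
      BSDTwoAdicLead (blindCurve m)

/-- **Assembly of THEOREM D** (kernel-checked): local terms (E-an-103, paper-proved by Tate) + the two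
c-free odd-degree inputs ⟹ BSD₂; the analytic-rank-0 hypothesis of Part C is DISCHARGED from the
cusp half-unit (`analyticRank_eq_zero_of_ratPlusSymbol_halfUnit`). -/
theorem blindTameOddDegreeBSDTwo_of (hLoc : BlindFamilyLocalTerms)
    (hC : BlindTameOddDegreeCuspHalf) (hM : BlindTameOddDegreeManinOdd) :
    BlindTameOddDegreeBSDTwo := by
  intro m hm h4 h3 hprime hfin N _ D hopt hdeg
  haveI := hfin
  haveI : Fact (Nat.Prime (m ^ 2 + 4).natAbs) := ⟨hprime⟩
  have hpm : (((m ^ 2 + 4).natAbs : ℕ) : ℤ) = m ^ 2 + 4 := by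
    rw [Int.natCast_natAbs]; exact abs_of_pos (by positivity)
  haveI := isElliptic_blindCurve hpm
  obtain ⟨ht, c₂, hc₂, hT⟩ := hLoc m hm h3 hprime
  have hα := hC m hm h4 h3 hprime D hopt hdeg
  exact blindCurve_bsdTwo_of_maninOdd_of_ratPlusSymbol hpm hm ht c₂ hc₂ hT
    (analyticRank_eq_zero_of_ratPlusSymbol_halfUnit D hα) D hopt (hM m hm h4 h3 hprime D hopt hdeg) hα

end OddDegree
end Summit.BirchSwinnertonDyer.Rank1Residual.ManinAdditive.BlindFamilyDescent

end
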